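import Mathlib

/-!
# FunctionalMining/NoGo — THEOREM N⁺, pointwise core: Euler strain production on the sharp class
# `S ∈ {m (I − 3 n⊗n)}` (staged by the no-go seat, cell `pub-nsfunc`, nogo gen 15)

Search for candidate a priori estimates; no regularity claim. The planner seat cannot file under
`FunctionalMining/`; this file is STAGED for the prove seat (`SIEVELD.md` v1.9w §3.4b (8b),
`pub-nsfunc-nogo/sieveld/THEOREM-Nplus.md`).

Context (informal, not formalised here). On the sharp class of the static E2 framework the strain is
`S(x) = m (I − 3 n(x)⊗n(x))` a.e. (eigenvalues `m, m, −2m`, top pair double with eigenplane `n^⊥`),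
`∇u = S + Ω` with `Ω v = ½ ω × v`, and the material strain tendency of the Euler part of the budget is
`δS = −sym((∇u)²) − ∇²p`. THEOREM N⁺ (i) is the pointwise identity
`nᵀ δS n = −4 m² + |Ω n|² − nᵀ ∇²p n`, `|Ω n|² = ¼ (|ω|² − (ω·n)²)`; part (ii) integrates it over a period
cell (`∫ nᵀ∇²p n = 0` because `n⊗n` is affine in `S` on the wells); part (iii) uses
`λ_max(H|_E) ≥ ½ tr(H|_E)` on the eigenplane. This file proves the finite-dimensional algebra of (i), the
trace identity behind `tr δS = 0`, the `2 × 2` eigenvalue inequality of (iii), the planar-subclass identity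
`(S_in + φ J)² = (m² − φ²) I₂` of (iv), and the scalar cell bookkeeping of (ii) as an implication between
real numbers (the integrals enter as hypotheses). Everything is stated HOMOGENEOUSLY in `|n|²`
(no normalisation hypothesis is needed for the polynomial identities); specialise with `|n|² = 1`.

All statements are elementary real algebra [ours, elementary; folklore restricted-Euler bookkeeping];
nothing is claimed about Navier–Stokes.
-/

noncomputable section

namespace Summit.NavierStokesRegularity.FunctionalMining.SharpClass

open Matrix

/-- Squared Euclidean norm of a `3`-vector, written out. -/
def nsq (n : Fin 3 → ℝ) : ℝ := n 0 ^ 2 + n 1 ^ 2 + n 2 ^ 2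

/-- The sharp-class strain, homogeneous form: `S = m (|n|² I − 3 n⊗n)`; for `|n| = 1` this is
`m (I − 3 n⊗n)` with eigenvalues `m, m, −2m`. -/
def sharpStrain (m : ℝ) (n : Fin 3 → ℝ) : Matrix (Fin 3) (Fin 3) ℝ :=
  !![m * (nsq n - 3 * n 0 * n 0), m * (-(3 * n 0 * n 1)), m * (-(3 * n 0 * n 2));
     m * (-(3 * n 1 * n 0)), m * (nsq n - 3 * n 1 * n 1), m * (-(3 * n 1 * n 2));
     m * (-(3 * n 2 * n 0)), m * (-(3 * n 2 * n 1)), m * (nsq n - 3 * n 2 * n 2)]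

/-- The spin tensor of a vorticity vector `w`: `Ω v = ½ w × v`. -/
def spin (w : Fin 3 → ℝ) : Matrix (Fin 3) (Fin 3) ℝ :=
  !![0, -(w 2 / 2), w 1 / 2; w 2 / 2, 0, -(w 0 / 2); -(w 1 / 2), w 0 / 2, 0]

/-- The velocity gradient on the sharp class: `∇u = S + Ω`. -/
def grad (m : ℝ) (n w : Fin 3 → ℝ) : Matrix (Fin 3) (Fin 3) ℝ := sharpStrain m n + spin w

/-- `n` is an eigenvector of the sharp strain: `S n = −2 m |n|² n`. -/
theorem sharpStrain_mulVec_self (m : ℝ) (n : Fin 3 → ℝ) :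
    (sharpStrain m n).mulVec n = (-(2 * m * nsq n)) • n := by
  ext i
  fin_cases i <;> simp [sharpStrain, nsq, Matrix.mulVec, dotProduct, Fin.sum_univ_three] <;> ring

/-- Every vector orthogonal to `n` is an eigenvector with eigenvalue `m |n|²` (the top pair, double). -/
theorem sharpStrain_mulVec_perp (m : ℝ) (n t : Fin 3 → ℝ)
    (ht : n 0 * t 0 + n 1 * t 1 + n 2 * t 2 = 0) :
    (sharpStrain m n).mulVec t = (m * nsq n) • t := by
  ext i
  fin_cases i
  · simp [sharpStrain, nsq, Matrix.mulVec, dotProduct, Fin.sum_univ_three]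
    linear_combination (-(3 * m * n 0)) * ht
  · simp [sharpStrain, nsq, Matrix.mulVec, dotProduct, Fin.sum_univ_three]
    linear_combination (-(3 * m * n 1)) * ht
  · simp [sharpStrain, nsq, Matrix.mulVec, dotProduct, Fin.sum_univ_three]
    linear_combination (-(3 * m * n 2)) * ht

/-- **The key to THEOREM N⁺ (ii).** On the wells `n⊗n` is AFFINE in `S`:
`3 m · n⊗n = m |n|² I − S`; hence `∫ nᵀ∇²p n = (1/3m)(m∫Δp − ∫∇²p : S) = 0` on a period cell
(`∫Δp = 0`, and `∫∇²p : S = 0` for divergence-free periodic `u`). -/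
theorem vecMulVec_eq (m : ℝ) (n : Fin 3 → ℝ) :
    (3 * m) • Matrix.vecMulVec n n = (m * nsq n) • (1 : Matrix (Fin 3) (Fin 3) ℝ) - sharpStrain m n := by
  ext i j
  fin_cases i <;> fin_cases j <;> simp [sharpStrain, nsq, Matrix.vecMulVec_apply] <;> ring

/-- `|S|² = 6 m² |n|⁴` (Frobenius), i.e. `∫|S|² = 6 m² V` per unit `|n| = 1`. -/
theorem sharpStrain_frobenius (m : ℝ) (n : Fin 3 → ℝ) :
    ∑ i, ∑ j, (sharpStrain m n) i j ^ 2 = 6 * m ^ 2 * (nsq n) ^ 2 := by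
  simp [sharpStrain, nsq, Fin.sum_univ_three]
  ring

/-- `|Ω n|² = ¼ (|n|²|w|² − (w·n)²)` (Lagrange's identity for `½ w × n`). -/
theorem spin_mulVec_normSq (w n : Fin 3 → ℝ) :
    dotProduct ((spin w).mulVec n) ((spin w).mulVec n)
      = (nsq n * nsq w - (w 0 * n 0 + w 1 * n 1 + w 2 * n 2) ^ 2) / 4 := by
  simp [spin, nsq, Matrix.mulVec, dotProduct, Fin.sum_univ_three]
  ring

/-- **THEOREM N⁺ (i), velocity-gradient part.** `nᵀ (∇u)² n = |S n|² − |Ω n|²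
`= 4 m² |n|⁶ − ¼ (|n|²|w|² − (w·n)²)`: the cross terms `nᵀ(SΩ + ΩS)n` cancel because `S n ∥ n` and
`Ω` is antisymmetric. -/
theorem quadForm_grad_sq (m : ℝ) (n w : Fin 3 → ℝ) :
    dotProduct n ((grad m n w * grad m n w).mulVec n)
      = 4 * m ^ 2 * (nsq n) ^ 3 - (nsq n * nsq w - (w 0 * n 0 + w 1 * n 1 + w 2 * n 2) ^ 2) / 4 := by
  simp [grad, sharpStrain, spin, nsq, Matrix.mulVec, dotProduct, Matrix.mul_apply,
    Fin.sum_univ_three]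
  ring

/-- `tr (∇u)² = |S|² − |Ω|² = 6 m² |n|⁴ − ½ |w|²`; with `Δp = −tr (∇u)²` this is what makes the material
strain tendency `δS = −sym((∇u)²) − ∇²p` trace-free. -/
theorem trace_grad_sq (m : ℝ) (n w : Fin 3 → ℝ) :
    Matrix.trace (grad m n w * grad m n w) = 6 * m ^ 2 * (nsq n) ^ 2 - nsq w / 2 := by
  simp [grad, sharpStrain, spin, nsq, Matrix.trace, Matrix.diag, Matrix.mul_apply,
    Fin.sum_univ_three]
  ring

/-- The material strain tendency `δS = −sym((∇u)²) − P` for a (pressure-Hessian) matrix `P`. -/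
def deltaS (m : ℝ) (n w : Fin 3 → ℝ) (P : Matrix (Fin 3) (Fin 3) ℝ) : Matrix (Fin 3) (Fin 3) ℝ :=
  -((1 / 2 : ℝ) • (grad m n w * grad m n w + (grad m n w * grad m n w).transpose)) - P

/-- Generic: the quadratic form of `−sym(M) − P` is `−nᵀMn − nᵀPn` (the antisymmetric part drops out). -/
theorem quadForm_negSym_sub (M P : Matrix (Fin 3) (Fin 3) ℝ) (n : Fin 3 → ℝ) :
    dotProduct n ((-((1 / 2 : ℝ) • (M + M.transpose)) - P).mulVec n)
      = -dotProduct n (M.mulVec n) - dotProduct n (P.mulVec n) := by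
  simp [Matrix.mulVec, dotProduct, Fin.sum_univ_three, Matrix.transpose_apply]
  ring

/-- **THEOREM N⁺ (i).** `nᵀ δS n = −4 m² |n|⁶ + ¼ (|n|²|w|² − (w·n)²) − nᵀ P n`; for `|n| = 1`:
`nᵀ δS n = −4 m² + |Ω n|² − nᵀ ∇²p n`. -/
theorem quadForm_deltaS (m : ℝ) (n w : Fin 3 → ℝ) (P : Matrix (Fin 3) (Fin 3) ℝ) :
    dotProduct n ((deltaS m n w P).mulVec n)
      = -(4 * m ^ 2 * (nsq n) ^ 3) + (nsq n * nsq w - (w 0 * n 0 + w 1 * n 1 + w 2 * n 2) ^ 2) / 4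
        - dotProduct n (P.mulVec n) := by
  rw [deltaS, quadForm_negSym_sub, quadForm_grad_sq]
  ring

/-- `tr δS = 0` exactly when `tr P = −tr (∇u)²` (the pressure Poisson equation `Δp = −tr (∇u)²`). -/
theorem trace_deltaS (m : ℝ) (n w : Fin 3 → ℝ) (P : Matrix (Fin 3) (Fin 3) ℝ)
    (hP : Matrix.trace P = -(6 * m ^ 2 * (nsq n) ^ 2 - nsq w / 2)) :
    Matrix.trace (deltaS m n w P) = 0 := by
  have h := trace_grad_sq m n w
  simp only [Matrix.trace, Matrix.diag, Fin.sum_univ_three] at h hP ⊢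
  simp only [deltaS, Matrix.sub_apply, Matrix.neg_apply, Matrix.smul_apply, Matrix.add_apply,
    Matrix.transpose_apply, smul_eq_mul]
  linarith

/-- **THEOREM N⁺ (iii), the `2 × 2` step.** For a real symmetric `2 × 2` block `[[a, b], [b, c]]` the
larger eigenvalue `(a + c)/2 + √(((a − c)/2)² + b²)` is at least the half-trace `(a + c)/2`. -/
theorem half_trace_le_lamMax₂ (a b c : ℝ) :
    (a + c) / 2 ≤ (a + c) / 2 + Real.sqrt (((a - c) / 2) ^ 2 + b ^ 2) := by
  have := Real.sqrt_nonneg (((a - c) / 2) ^ 2 + b ^ 2)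
  linarith

/-- The larger eigenvalue of `[[a, b], [b, c]]` is an eigenvalue bound: `vᵀ H v ≤ λ_max |v|²`
(so `λ_max` dominates the Rayleigh quotient; used with (iii) to read `φ′(S; δS) = q m^{q−1} λ_max(δS|_E)`). -/
theorem rayleigh_le_lamMax₂ (a b c x y : ℝ) :
    a * x ^ 2 + 2 * b * x * y + c * y ^ 2
      ≤ ((a + c) / 2 + Real.sqrt (((a - c) / 2) ^ 2 + b ^ 2)) * (x ^ 2 + y ^ 2) := by
  set r := Real.sqrt (((a - c) / 2) ^ 2 + b ^ 2) with hr
  have hr0 : 0 ≤ r := Real.sqrt_nonneg _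
  have hr2 : r ^ 2 = ((a - c) / 2) ^ 2 + b ^ 2 := by
    rw [hr, Real.sq_sqrt]; positivity
  -- `λ_max |v|² − vᵀHv = r|v|² − (d (x² − y²) + 2 b x y)` with `d = (a − c)/2`, and
  -- `(d (x²−y²) + 2bxy)² ≤ (d² + b²)(x² + y²)² = r² |v|⁴` (Cauchy–Schwarz in `ℝ²`).
  have key : ((a - c) / 2 * (x ^ 2 - y ^ 2) + b * (2 * x * y)) ^ 2
      ≤ r ^ 2 * (x ^ 2 + y ^ 2) ^ 2 := by
    rw [hr2]
    nlinarith [sq_nonneg ((a - c) / 2 * (2 * x * y) - b * (x ^ 2 - y ^ 2)),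
      sq_nonneg (x ^ 2 + y ^ 2)]
  have hv : 0 ≤ x ^ 2 + y ^ 2 := by positivity
  have h1 : (a - c) / 2 * (x ^ 2 - y ^ 2) + b * (2 * x * y) ≤ r * (x ^ 2 + y ^ 2) := by
    nlinarith [key, hr0, hv, mul_nonneg hr0 hv]
  nlinarith [h1, hr0, hv]

/-! ## Planar subclass (7a): `(S_in + φ J)² = (m²|d|⁴ − φ²) I₂` -/

/-- In-plane sharp strain, homogeneous form `m (|d|² I₂ − 2 d⊗d)` (trace-free, `S_in² = m²|d|⁴ I₂`). -/
def planarStrain (m d₀ d₁ : ℝ) : Matrix (Fin 2) (Fin 2) ℝ :=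
  !![m * (d₀ ^ 2 + d₁ ^ 2 - 2 * d₀ * d₀), m * (-(2 * d₀ * d₁));
     m * (-(2 * d₁ * d₀)), m * (d₀ ^ 2 + d₁ ^ 2 - 2 * d₁ * d₁)]

/-- In-plane velocity gradient `S_in + φ J`, `J` = rotation by `+90°`. -/
def planarGrad (m φ d₀ d₁ : ℝ) : Matrix (Fin 2) (Fin 2) ℝ :=
  planarStrain m d₀ d₁ + !![0, -φ; φ, 0]

/-- **THEOREM N⁺ (iv), pointwise core.** `(S_in + φ J)² = (m² |d|⁴ − φ²) I₂`: on the planar sharp class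
the in-plane velocity gradient squares to a multiple of the identity, so `tr (∇u)² = 2 (m² − φ²)` for
`|d| = 1` and (integrating `Δp = −tr(∇u)²` over a cell) `⟨φ²⟩ = m²`. -/
theorem planarGrad_sq (m φ d₀ d₁ : ℝ) :
    planarGrad m φ d₀ d₁ * planarGrad m φ d₀ d₁
      = (m ^ 2 * (d₀ ^ 2 + d₁ ^ 2) ^ 2 - φ ^ 2) • (1 : Matrix (Fin 2) (Fin 2) ℝ) := by
  ext i j
  fin_cases i <;> fin_cases j <;>
    simp [planarGrad, planarStrain, Matrix.mul_apply, Fin.sum_univ_two] <;> ring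

/-- The planar design embedded in `ℝ³` (coordinates `x, y, z`; `u = (u_x(x,z), w(x,z), u_z(x,z))`,
`∇w = −c d`): the `3 × 3` velocity gradient `G i j = ∂_j u_i` (the `y`-column vanishes). For the sharp
class one takes `|d| = 1`, `c = 2√2 m` and `n = (√(2/3) d₀, 1/√3, √(2/3) d₁)`; the identities below are
stated for arbitrary parameters (they are polynomial). -/
def planarGrad₃ (m φ c d₀ d₁ : ℝ) : Matrix (Fin 3) (Fin 3) ℝ :=
  !![m * (d₀ ^ 2 + d₁ ^ 2 - 2 * d₀ * d₀), 0, m * (-(2 * d₀ * d₁)) - φ;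
     -(c * d₀), 0, -(c * d₁);
     m * (-(2 * d₁ * d₀)) + φ, 0, m * (d₀ ^ 2 + d₁ ^ 2 - 2 * d₁ * d₁)]

/-- Vorticity of a velocity gradient `G i j = ∂_j u_i`: `ω = (∂_y u_z − ∂_z u_y, ∂_z u_x − ∂_x u_z,
∂_x u_y − ∂_y u_x)`. -/
def curl₃ (G : Matrix (Fin 3) (Fin 3) ℝ) : Fin 3 → ℝ :=
  ![G 2 1 - G 1 2, G 0 2 - G 2 0, G 1 0 - G 0 1]

/-- `tr (∇u)² = 2 (m²|d|⁴ − φ²)` for the embedded planar design (the `y`-row/column do not contribute);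
with `Δp = −tr(∇u)²`, `∫_cell Δp = 0` and `|d| = 1` this gives `⟨φ²⟩ = m²` (THEOREM N⁺ (iv)). -/
theorem trace_planarGrad₃_sq (m φ c d₀ d₁ : ℝ) :
    Matrix.trace (planarGrad₃ m φ c d₀ d₁ * planarGrad₃ m φ c d₀ d₁)
      = 2 * (m ^ 2 * (d₀ ^ 2 + d₁ ^ 2) ^ 2 - φ ^ 2) := by
  simp [planarGrad₃, Matrix.trace, Matrix.diag, Matrix.mul_apply, Fin.sum_univ_three]
  ring

/-- `ω · n = −2 b φ` for `n = (a d₀, b, a d₁)`: the in-plane rotation `φ` is the normal vorticity; with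
`b = 1/√3` (sharp class), `(ω·n)² = (4/3) φ²`, so `¼∫(ω·n)² = ⅓∫φ² = ⅓ m² V` and the cell identity reads
`∫ nᵀδS n = −(4/3) m² V` on the planar subclass (THEOREM N⁺ (iv)). -/
theorem planar_vorticity_normal (m φ c d₀ d₁ a b : ℝ) :
    dotProduct (curl₃ (planarGrad₃ m φ c d₀ d₁)) ![a * d₀, b, a * d₁] = -(2 * b * φ) := by
  simp [curl₃, planarGrad₃, dotProduct, Fin.sum_univ_three]
  ring

/-- The planar cell identity as bookkeeping: `Q = −m²V − B/4` with `B = ∫(ω·n)² = (4/3)∫φ²` and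
`∫φ² = m² V` gives `Q = −(4/3) m² V`. -/
theorem planar_cell_identity (m V B Φ Q : ℝ) (hQ : Q = -(m ^ 2 * V) - B / 4)
    (hB : B = 4 / 3 * Φ) (hΦ : Φ = m ^ 2 * V) : Q = -(4 / 3 * (m ^ 2 * V)) := by
  rw [hQ, hB, hΦ]; ring

/-! ## Cell bookkeeping of THEOREM N⁺ (ii)–(iii) as real arithmetic

The integrals enter as real numbers with the identities they satisfy on a period cell of volume `V`
(all for `|n| = 1`): `W = ∫|ω|² = 2∫|Ω|² = 2∫|S|² = 12 m² V` (div-free periodic `u`),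
`A = ∫|Ω n|² = (W − B)/4` with `B = ∫(ω·n)²` (from `spin_mulVec_normSq`), `Pr = ∫ nᵀ∇²p n = 0`
(`n⊗n = (I − S/m)/3`, `∫∇²p : S = 0`, `∫Δp = 0`), `Q = ∫ nᵀ δS n = −4 m² V + A − Pr`
(from `quadForm_deltaS`). Conclusion: `Q = −m² V − B/4 ≤ −m² V`, and the production floor
`N ≥ (q/2) m^{q−1} (−Q) ≥ (q/2) m^{q−1} m² V = (q/2)·m·F_q` with `F_q = m^q V`. -/

/-- **THEOREM N⁺ (ii).** The cell identity `∫ nᵀδS n = −m²V − ¼∫(ω·n)²`, as bookkeeping. Here `m`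
is ONE real number, the CONSTANT value of the top eigenvalue on the period cell: the affine identity
`3m·n⊗n = m|n|²I − S` and `W = 12m²V` are used with this single `m` (referee F59.1). -/
theorem cell_identity (m V W A B Pr Q : ℝ)
    (hW : W = 12 * m ^ 2 * V) (hA : A = (W - B) / 4) (hPr : Pr = 0)
    (hQ : Q = -(4 * m ^ 2 * V) + A - Pr) :
    Q = -(m ^ 2 * V) - B / 4 := by
  subst hPr; rw [hQ, hA, hW]; ring

/-- **THEOREM N⁺ (iii).** If the production satisfies `N ≥ (q/2) m^{q−1} (−Q)` (from `φ′(S;H) =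
q m^{q−1} λ_max(H|_E) ≥ (q/2) m^{q−1} tr(H|_E) = −(q/2) m^{q−1} nᵀHn` for trace-free `H`, integrated) and
`Q = −m²V − B/4` with `B = ∫(ω·n)² ≥ 0`, then `N ≥ (q/2)·m·F_q` where `F_q = m^q V`. In the Lean
statement `m` is constant on the cell and the common factor `m^{q−1}` has been divided out: the
hypothesis `hprod : (q/2)(m²V + B/4) ≤ N` and the conclusion `(q/2) m²V ≤ N` are the displayed
inequalities for `N/m^{q−1}` in place of `N` (so the conclusion reads `N ≥ (q/2) m^{q+1} V = (q/2)·m·F_q`;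
referee F59.1). -/
theorem production_floor (q m V B N : ℝ) (hq : 0 ≤ q) (hB : 0 ≤ B)
    (hprod : q / 2 * (m ^ 2 * V + B / 4) ≤ N) :
    q / 2 * (m ^ 2 * V) ≤ N := by
  have : 0 ≤ q / 2 * (B / 4) := by positivity
  nlinarith [hprod, this]

end Summit.NavierStokesRegularity.FunctionalMining.SharpClass

end
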